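import Literature.AlgebraicGeometry.Resolution.PointBlowupGiraudForm

/-!
# Sanity lemmas for the germ predicates `IsSmoothAt0` / `TransversalAt0` (pub-rosobs REVIEW-RUNBOOK)

Review evidence only (ops-runbook sanity registry `registry/pub-rosobs.json`); no new definitions.
`IsSmoothAt0 q` = "the linear part of `q` is non-zero", `TransversalAt0 q q'` = "the linear parts are
linearly independent" (`Literature/AlgebraicGeometry/Resolution/PointBlowupGiraudForm.lean`).

* holds: the axes `y_i = 0` are smooth germs; the two axes are transversal (either order);
* fails: the node `y₀y₁`, the double line `y₀²` and the zero germ are not smooth at `0` (no linear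
  part); a germ is never transversal to itself; the axis `y₀` and the tangent parabola `y₀ + y₁²` are
  not transversal (same linear part) although both are smooth — so neither predicate is trivially
  true or trivially false, and transversality is strictly stronger than smoothness of the pair.
-/

open MvPolynomial

namespace Summit.ResolutionOfSingularities.KangarooAtlas.Runbook

open Literature.AlgebraicGeometry.Resolution Literature.AlgebraicGeometry.Resolution.Giraud1983

variable {K : Type*} [Field K]

/-- The linear part of a coordinate germ `y_i` is `y_i` itself. -/
theorem homogeneousComponent_one_X (i : Fin 2) : homogeneousComponent 1 (X i : A K) = X i :=
  homogeneousComponent_eq_self (isHomogeneous_X K i)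

/-- A form of degree `n ≠ 1` has no linear part. -/
theorem homogeneousComponent_one_eq_zero {q : A K} {n : ℕ} (hq : q.IsHomogeneous n) (hn : n ≠ 1) :
    homogeneousComponent 1 q = 0 := by
  rw [homogeneousComponent_of_mem (n := n) ((mem_homogeneousSubmodule n q).mpr hq), if_neg hn.symm]

/-! ## `IsSmoothAt0` -/

/-- Holds-instance: each axis `y_i = 0` is a smooth germ at the origin. -/
theorem isSmoothAt0_X (i : Fin 2) : IsSmoothAt0 (X i : A K) := by
  show homogeneousComponent 1 (X i : A K) ≠ 0
  rw [homogeneousComponent_one_X]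
  exact X_ne_zero _

/-- Fails-instance: the node `y₀ y₁ = 0` is not a smooth germ (its equation has no linear part). -/
theorem not_isSmoothAt0_X_mul_X : ¬ IsSmoothAt0 (X 0 * X 1 : A K) := by
  intro h
  exact h (homogeneousComponent_one_eq_zero ((isHomogeneous_X K 0).mul (isHomogeneous_X K 1)) (by decide))

/-- Fails-instance: the double line `y₀² = 0` is not a smooth germ. -/
theorem not_isSmoothAt0_X_sq : ¬ IsSmoothAt0 (X 0 ^ 2 : A K) := by
  intro h
  exact h (homogeneousComponent_one_eq_zero (isHomogeneous_X_pow (0 : Fin 2) 2) (by decide))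

/-- Fails-instance (degenerate): the zero germ is not smooth. -/
theorem not_isSmoothAt0_zero : ¬ IsSmoothAt0 (0 : A K) := by
  intro h
  exact h (map_zero _)

/-! ## `TransversalAt0` -/

/-- Holds-instance: the two axes are transversal at the origin. -/
theorem transversalAt0_X_zero_X_one : TransversalAt0 (X 0 : A K) (X 1) := by
  show LinearIndependent K ![homogeneousComponent 1 (X 0 : A K), homogeneousComponent 1 (X 1)]
  rw [homogeneousComponent_one_X, homogeneousComponent_one_X]
  have hfun : (![X 0, X 1] : Fin 2 → A K) = (X : Fin 2 → A K) ∘ ![0, 1] := by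
    ext i : 1
    fin_cases i <;> rfl
  rw [hfun]
  exact (linearIndependent_X (Fin 2) K).comp _ (by decide)

/-- Transversality is symmetric (so the other order holds too). -/
theorem TransversalAt0.symm {q q' : A K} (h : TransversalAt0 q q') : TransversalAt0 q' q := by
  unfold TransversalAt0 at h ⊢
  have hfun : (![homogeneousComponent 1 q', homogeneousComponent 1 q] : Fin 2 → A K) =
      ![homogeneousComponent 1 q, homogeneousComponent 1 q'] ∘ Equiv.swap (0 : Fin 2) 1 := by
    ext i : 1
    fin_cases i <;> rfl
  rw [hfun]
  exact h.comp _ (Equiv.injective _)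

/-- Fails-instance: no germ is transversal to itself (the pair of linear parts repeats). -/
theorem not_transversalAt0_self (q : A K) : ¬ TransversalAt0 q q := by
  intro h
  have h01 : (0 : Fin 2) = 1 :=
    h.injective (show ![homogeneousComponent 1 q, homogeneousComponent 1 q] 0 =
      ![homogeneousComponent 1 q, homogeneousComponent 1 q] 1 from rfl)
  exact absurd h01 (by decide)

/-- The tangent parabola `y₀ + y₁² = 0` is a smooth germ with linear part `y₀` … -/
theorem homogeneousComponent_one_X_add_X_sq :
    homogeneousComponent 1 (X 0 + X 1 ^ 2 : A K) = X 0 := by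
  rw [map_add, homogeneousComponent_one_X,
    homogeneousComponent_one_eq_zero (isHomogeneous_X_pow (1 : Fin 2) 2) (by decide), add_zero]

/-- … so it is smooth at the origin … -/
theorem isSmoothAt0_X_add_X_sq : IsSmoothAt0 (X 0 + X 1 ^ 2 : A K) := by
  show homogeneousComponent 1 (X 0 + X 1 ^ 2 : A K) ≠ 0
  rw [homogeneousComponent_one_X_add_X_sq]
  exact X_ne_zero _

/-- … but NOT transversal to the axis `y₀ = 0` (fails-instance with both germs smooth: tangency). -/
theorem not_transversalAt0_X_tangent : ¬ TransversalAt0 (X 0 : A K) (X 0 + X 1 ^ 2) := by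
  intro h
  unfold TransversalAt0 at h
  rw [homogeneousComponent_one_X, homogeneousComponent_one_X_add_X_sq] at h
  have h01 : (0 : Fin 2) = 1 := h.injective (show ![(X 0 : A K), X 0] 0 = ![(X 0 : A K), X 0] 1 from rfl)
  exact absurd h01 (by decide)

end Summit.ResolutionOfSingularities.KangarooAtlas.Runbook
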